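import Summits.QuantumFields.BalabanUV.Beta.FP.MixLoopPowerCountingCubic

/-!
# `BalabanUV.Beta.FP.MixLoopPowerCountingCubicMoment` — road «FP» (binder row D1), remainder `ρ_n` of the H′ bookkeeping, row **RHOA-6c** «GENERIC POWER
# COUNTING OF THE MIX LOOPS», FILE D: the loop **(MIX-3)** `−2·tr(Q̇·Γ₀·Ḣ·𝓘)` — its SECOND MOMENT from the letters, summed VERTEX-FIRST over the cubic-vertex leg of
# FILE C ([folklore] lattice bookkeeping on `ℤ⁴`; abstract kernels, every letter a displayed hypothesis; NO road object)

HONEST DEPENDENCY (page 1, mandatory): continuum YM on T⁴ ⇐ BetaPertH ∧ nine spine estimates (0/9 proved); BetaPertH ⇐ (D1) ∧ (D4) ∧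
CAP+tail; G-an2-4 gates asym, D1 and NE2/3/4.  HONEST FRAMING (cell contract, verbatim): «discharging `BetaPertH` makes Bałaban's UV
stability UNCONDITIONAL — a real constructive-QFT result; it is NOT the continuum limit and NOT the Clay problem.»  THIS MODULE is elementary
[folklore] real analysis on `ℤ⁴` over FILE A's shell engine (`MixLoopPowerCounting.sum_le_engine_of_le`), FILE C's leg (`MixLoopPowerCountingCubic.abs_cubicLeg_le`),
`ExpKernelCalculus.summable_exp_shift'`∕`tsum_exp_shift'` (`Zl`) and `LatticeConvolutionBounds.sum_inv_pow_le`; it asserts nothing about Bałaban's objects, cites nothing,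
mints no `Prop` fact, has no `def`, 0 sorry.  The LETTERS of `q̇` (mass `A∕n³`, field-leg radius `n`; row RHOA-6b), `𝓘` (sup letter `C_I`; row IR-I), `Γ₀` (sup + first
differences; rows IR-1∕IR-Q∕IR-5) and `Ḣ` (exponential localisation + ZERO MASS; `H2V-DESIGN` §2) are HYPOTHESES displayed in the signatures; NOT `Mix_n = O(1)` for Bałaban's
objects (row RHOA-6e assembles), NOT `hbook`, NOT D1, NOT BetaPertH, NOT continuum, NOT Clay.

ROW (owner b2b-balaban-beta-d1-p3-g6, `RHOA-DESIGN.md` v1.1 §2bis (MIX-3); power counting «`n⁻³Σ_z(|z|+1)⁻¹ ~ n⁻³·n³ = O(1)`»).  THE LOOP KERNEL: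
`k₃(b,b′) = Σ_{u∈U b} Σ_{w∈W} q̇(u;b,b+w)·T(b+w,b′,u)`, `T(c,b′,u) := Σ'_{x′} 𝓘(x′,u)·Σ'_x Γ₀(c,x)·Ḣ(b′;x,x′)`.  HOW: `|T| ≤ C_I·C_H·Zl(δ_H)·Φ(‖c−b′‖)` with FILE C's
profile `Φ(r) = K₁e^{−(3δ∕4n)r}∕(r+1)³ + K₂∕(r+1)⁸` (`abs_cubicT_le`); then `Σ_{b′}‖b′−b‖²|k₃| ≤ Σ_{u,w}|q̇|·C_IC_HZl·Σ_{b′}‖b′−b‖²Φ(‖b+w−b′‖)` and the profile's second moment is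
`≤ 𝔎·n³` (`sum_sq_shift_mixedProfile_le`: `‖b′−b‖² ≤ 2‖c−b′‖² + 2n²`, the engine at `j = 2, 0`, `Σ(‖y‖+1)^{−6}, Σ(‖y‖+1)^{−8} ≤ 81`, `1 + n² ≤ 2n³`) against the mass `A∕n³`:
EXACT power `n⁰`.  ONLY the sup letter of `𝓘` is used (its localisation is idle here).

CONTENT.
* §1 engine instances `sum_inv_cube_mul_exp_le` (`j = 0`: `n`), `sum_sq_div_cube_mul_exp_le` (`j = 2`: `n³`); **`sum_sq_shift_mixedProfile_le`** (`≤ 𝔎·n³`,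
  `𝔎 = K₁(2(1+160e^{δ′∕2}(2∕δ′)³) + 2(1+80e^{δ′∕2}(2∕δ′))) + 324K₂`).
* §4 `abs_cubicT_le` (summability included), **`mix3_secondMoment_le`** (`Σ_{b′∈S}‖b′−b‖∞²·|k₃(b,b′)| ≤ A·C_I·(C_H·Zl 4 δ_H)·𝔎` at `δ′ = 3δ∕4`, n-FREE, every finite `S`),
  `tsum_mix3_secondMoment_le` (the summable ∕ `tsum` form over all `b′ ∈ ℤ⁴`).
Provenance: cross-cell idle-seat kernel duty NE7b → β∕D1, unit `b2b-balaban-t4-ne7b-formalise-leaf-01` gen 23, 2026-08-21; journal INTENT ∕ CLAIM «RHOA-6c» l.23908;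
«not in print; our bookkeeping»; no existing file touched.
-/

noncomputable section

namespace Summit.QuantumFields.BalabanUV.Beta.FP.MixLoopPowerCountingCubicMoment

open Finset Real
open scoped BigOperators
open Literature.MathematicalPhysics.QuantumFieldTheory.Balaban1983to89
open Literature.MathematicalPhysics.QuantumFieldTheory.Balaban1983to89.Beta
open B12Sec2to5 (l1 l1_nonneg)
open ExpKernelCalculus (Site Zl Zl_pos summable_exp_shift' tsum_exp_shift')
open DyadicShell (Pt supNorm)
open BlockLegs (supNorm_sub_le_real supNorm_add_le_real)
open Summit.QuantumFields.BalabanUV.Beta.FP.LatticeConvolutionBounds (sum_inv_pow_le)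
open Summit.QuantumFields.BalabanUV.Beta.FP.MixLoopPowerCounting (sum_le_engine_of_le supNorm_cast_nonneg)
open Summit.QuantumFields.BalabanUV.Beta.FP.MixLoopPowerCountingCubic (abs_cubicLeg_le)

/-! ## §1 Engine instances `j = 0, 2` and the second moment of the MIX-3 profile -/

/-- [folklore] **INVERSE CUBE × EXPONENTIAL, EXACT POWER n¹**: `Σ_{z∈S} e^{−(δ∕n)‖z‖∞}∕(‖z‖∞+1)³ ≤ (1 + 80·e^{δ∕2}·(2∕δ))·n`. -/
theorem sum_inv_cube_mul_exp_le {δ : ℝ} (hδ : 0 < δ) {n : ℕ} (hn : 1 ≤ n) (S : Finset Pt) :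
    ∑ z ∈ S, Real.exp (-(δ / n) * (supNorm z : ℝ)) / ((supNorm z : ℝ) + 1) ^ 3
      ≤ (1 + 80 * Real.exp (δ / 2) * (2 / δ)) * (n : ℝ) := by
  have h := sum_le_engine_of_le 0 hδ hn (w := fun z => Real.exp (-(δ / n) * (supNorm z : ℝ)) / ((supNorm z : ℝ) + 1) ^ 3)
    (fun z => ?_) S
  · refine h.trans (le_of_eq ?_); norm_num [Nat.factorial]
  · rw [pow_zero, div_mul_eq_mul_div, one_mul]

/-- [folklore] **SECOND MOMENT OF INVERSE CUBE × EXPONENTIAL, EXACT POWER n³**: `Σ_{z∈S} ‖z‖∞²·e^{−(δ∕n)‖z‖∞}∕(‖z‖∞+1)³ ≤ (1 + 160·e^{δ∕2}·(2∕δ)³)·n³`. -/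
theorem sum_sq_div_cube_mul_exp_le {δ : ℝ} (hδ : 0 < δ) {n : ℕ} (hn : 1 ≤ n) (S : Finset Pt) :
    ∑ z ∈ S, (supNorm z : ℝ) ^ 2 * Real.exp (-(δ / n) * (supNorm z : ℝ)) / ((supNorm z : ℝ) + 1) ^ 3
      ≤ (1 + 160 * Real.exp (δ / 2) * (2 / δ) ^ 3) * (n : ℝ) ^ 3 := by
  have h := sum_le_engine_of_le 2 hδ hn
    (w := fun z => (supNorm z : ℝ) ^ 2 * Real.exp (-(δ / n) * (supNorm z : ℝ)) / ((supNorm z : ℝ) + 1) ^ 3) (fun z => ?_) S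
  · refine h.trans (le_of_eq ?_); norm_num [Nat.factorial]
  · have h0 := supNorm_cast_nonneg z
    have h1 : (0 : ℝ) < (supNorm z : ℝ) + 1 := by linarith
    rw [div_mul_eq_mul_div, div_le_div_iff₀ (pow_pos h1 3) (pow_pos h1 3)]
    have : (supNorm z : ℝ) ^ 2 ≤ ((supNorm z : ℝ) + 1) ^ 2 := by gcongr; linarith
    exact mul_le_mul_of_nonneg_right (mul_le_mul_of_nonneg_right this (Real.exp_pos _).le) (pow_pos h1 3).le

/-- [folklore] **THE MIX-3 PROFILE'S SECOND MOMENT, EXACT POWER n³**: for a field point `c` within `n` of the insertion `b`, nonnegative `K₁, K₂` and a rate `δ′ > 0`,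
`Σ_{b′∈S} ‖b′−b‖²·(K₁e^{−(δ′∕n)‖c−b′‖}∕(‖c−b′‖+1)³ + K₂∕(‖c−b′‖+1)⁸) ≤ (K₁(2(1+160e^{δ′∕2}(2∕δ′)³) + 2(1+80e^{δ′∕2}(2∕δ′))) + 324·K₂)·n³`
(`‖b′−b‖² ≤ 2‖c−b′‖² + 2n²`; the engine at `j = 2, 0`; `Σ(‖y‖+1)^{−6}, Σ(‖y‖+1)^{−8} ≤ 81`, `1 + n² ≤ 2n³`). -/
theorem sum_sq_shift_mixedProfile_le {δ' K₁ K₂ : ℝ} (hδ' : 0 < δ') (hK₁ : 0 ≤ K₁) (hK₂ : 0 ≤ K₂) {n : ℕ} (hn : 1 ≤ n) {b c : Pt}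
    (hc : supNorm (c - b) ≤ n) (S : Finset Pt) :
    ∑ b' ∈ S, (supNorm (b' - b) : ℝ) ^ 2 *
        (K₁ * (Real.exp (-(δ' / n) * (supNorm (c - b') : ℝ)) / ((supNorm (c - b') : ℝ) + 1) ^ 3) + K₂ / ((supNorm (c - b') : ℝ) + 1) ^ 8)
      ≤ (K₁ * (2 * (1 + 160 * Real.exp (δ' / 2) * (2 / δ') ^ 3) + 2 * (1 + 80 * Real.exp (δ' / 2) * (2 / δ'))) + 324 * K₂)
          * (n : ℝ) ^ 3 := by
  have hn' : (1 : ℝ) ≤ n := by exact_mod_cast hn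
  have hn0 : (0 : ℝ) < n := by linarith
  -- the four summands of the majorant, as functions of `y = c − b′`
  set g : Pt → ℝ := fun y =>
      K₁ * (2 * ((supNorm y : ℝ) ^ 2 * Real.exp (-(δ' / n) * (supNorm y : ℝ)) / ((supNorm y : ℝ) + 1) ^ 3)
        + 2 * (n : ℝ) ^ 2 * (Real.exp (-(δ' / n) * (supNorm y : ℝ)) / ((supNorm y : ℝ) + 1) ^ 3))
      + K₂ * (2 * (1 / ((supNorm y : ℝ) + 1) ^ 6) + 2 * (n : ℝ) ^ 2 * (1 / ((supNorm y : ℝ) + 1) ^ 8)) with hg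
  have hterm : ∀ b' ∈ S, (supNorm (b' - b) : ℝ) ^ 2 *
      (K₁ * (Real.exp (-(δ' / n) * (supNorm (c - b') : ℝ)) / ((supNorm (c - b') : ℝ) + 1) ^ 3) + K₂ / ((supNorm (c - b') : ℝ) + 1) ^ 8)
        ≤ g (c - b') := by
    intro b' _
    set y : Pt := c - b' with hy
    have hys := supNorm_cast_nonneg y
    have h1 : (0 : ℝ) < (supNorm y : ℝ) + 1 := by linarith
    have htri : (supNorm (b' - b) : ℝ) ≤ (supNorm y : ℝ) + n := by
      have e : b' - b = (c - b) - y := by rw [hy]; abel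
      have h2 := supNorm_sub_le_real (c - b) y
      have h4 : (supNorm (c - b) : ℝ) ≤ n := by exact_mod_cast hc
      rw [e]; linarith
    have hsq : (supNorm (b' - b) : ℝ) ^ 2 ≤ 2 * (supNorm y : ℝ) ^ 2 + 2 * (n : ℝ) ^ 2 := by
      have h0 : (0 : ℝ) ≤ (supNorm (b' - b) : ℝ) := supNorm_cast_nonneg _
      have h2 : (supNorm (b' - b) : ℝ) ^ 2 ≤ ((supNorm y : ℝ) + n) ^ 2 := pow_le_pow_left₀ h0 htri 2
      nlinarith [h2, sq_nonneg ((supNorm y : ℝ) - n)]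
    set E : ℝ := Real.exp (-(δ' / n) * (supNorm y : ℝ)) with hE
    have hE0 : 0 < E := Real.exp_pos _
    -- `‖y‖²/(‖y‖+1)⁸ ≤ 1/(‖y‖+1)⁶`
    have h68 : (supNorm y : ℝ) ^ 2 * (1 / ((supNorm y : ℝ) + 1) ^ 8) ≤ 1 / ((supNorm y : ℝ) + 1) ^ 6 := by
      rw [mul_one_div, div_le_div_iff₀ (pow_pos h1 8) (pow_pos h1 6)]
      have : (supNorm y : ℝ) ^ 2 ≤ ((supNorm y : ℝ) + 1) ^ 2 := by gcongr; linarith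
      nlinarith [pow_pos h1 6, this]
    have eK2 : K₂ / ((supNorm y : ℝ) + 1) ^ 8 = K₂ * (1 / ((supNorm y : ℝ) + 1) ^ 8) := by rw [mul_one_div]
    rw [eK2]
    calc (supNorm (b' - b) : ℝ) ^ 2 * (K₁ * (E / ((supNorm y : ℝ) + 1) ^ 3) + K₂ * (1 / ((supNorm y : ℝ) + 1) ^ 8))
        ≤ (2 * (supNorm y : ℝ) ^ 2 + 2 * (n : ℝ) ^ 2) * (K₁ * (E / ((supNorm y : ℝ) + 1) ^ 3) + K₂ * (1 / ((supNorm y : ℝ) + 1) ^ 8)) :=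
          mul_le_mul_of_nonneg_right hsq (by positivity)
      _ = K₁ * (2 * ((supNorm y : ℝ) ^ 2 * E / ((supNorm y : ℝ) + 1) ^ 3) + 2 * (n : ℝ) ^ 2 * (E / ((supNorm y : ℝ) + 1) ^ 3))
          + K₂ * (2 * ((supNorm y : ℝ) ^ 2 * (1 / ((supNorm y : ℝ) + 1) ^ 8)) + 2 * (n : ℝ) ^ 2 * (1 / ((supNorm y : ℝ) + 1) ^ 8)) := by
          ring
      _ ≤ K₁ * (2 * ((supNorm y : ℝ) ^ 2 * E / ((supNorm y : ℝ) + 1) ^ 3) + 2 * (n : ℝ) ^ 2 * (E / ((supNorm y : ℝ) + 1) ^ 3))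
          + K₂ * (2 * (1 / ((supNorm y : ℝ) + 1) ^ 6) + 2 * (n : ℝ) ^ 2 * (1 / ((supNorm y : ℝ) + 1) ^ 8)) := by
          gcongr
      _ = g y := by rw [hg]
  -- reindex and sum the four pieces
  have hinj : Set.InjOn (fun b' : Pt => c - b') S := fun x _ x' _ h => sub_right_injective h
  set S' := S.image (fun b' => c - b') with hS'
  have hsum : ∑ b' ∈ S, g (c - b') = ∑ y ∈ S', g y := (Finset.sum_image hinj).symm
  have hA := sum_sq_div_cube_mul_exp_le hδ' hn S'
  have hB := sum_inv_cube_mul_exp_le hδ' hn S'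
  have hC : ∑ y ∈ S', 1 / ((supNorm y : ℝ) + 1) ^ 6 ≤ 81 := sum_inv_pow_le (by norm_num) S'
  have hD : ∑ y ∈ S', 1 / ((supNorm y : ℝ) + 1) ^ 8 ≤ 81 := sum_inv_pow_le (by norm_num) S'
  have hn3 : (1 : ℝ) + (n : ℝ) ^ 2 ≤ 2 * (n : ℝ) ^ 3 := by nlinarith [hn', pow_le_pow_left₀ zero_le_one hn' 2]
  calc _ ≤ ∑ b' ∈ S, g (c - b') := Finset.sum_le_sum hterm
    _ = ∑ y ∈ S', g y := hsum
    _ = K₁ * (2 * ∑ y ∈ S', (supNorm y : ℝ) ^ 2 * Real.exp (-(δ' / n) * (supNorm y : ℝ)) / ((supNorm y : ℝ) + 1) ^ 3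
          + 2 * (n : ℝ) ^ 2 * ∑ y ∈ S', Real.exp (-(δ' / n) * (supNorm y : ℝ)) / ((supNorm y : ℝ) + 1) ^ 3)
        + K₂ * (2 * ∑ y ∈ S', 1 / ((supNorm y : ℝ) + 1) ^ 6 + 2 * (n : ℝ) ^ 2 * ∑ y ∈ S', 1 / ((supNorm y : ℝ) + 1) ^ 8) := by
        rw [hg]
        simp only [Finset.sum_add_distrib, ← Finset.mul_sum]
    _ ≤ K₁ * (2 * ((1 + 160 * Real.exp (δ' / 2) * (2 / δ') ^ 3) * (n : ℝ) ^ 3)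
          + 2 * (n : ℝ) ^ 2 * ((1 + 80 * Real.exp (δ' / 2) * (2 / δ')) * (n : ℝ)))
        + K₂ * (2 * 81 + 2 * (n : ℝ) ^ 2 * 81) := by gcongr
    _ = (K₁ * (2 * (1 + 160 * Real.exp (δ' / 2) * (2 / δ') ^ 3) + 2 * (1 + 80 * Real.exp (δ' / 2) * (2 / δ')))) * (n : ℝ) ^ 3
        + 162 * K₂ * (1 + (n : ℝ) ^ 2) := by ring
    _ ≤ (K₁ * (2 * (1 + 160 * Real.exp (δ' / 2) * (2 / δ') ^ 3) + 2 * (1 + 80 * Real.exp (δ' / 2) * (2 / δ')))) * (n : ℝ) ^ 3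
        + 162 * K₂ * (2 * (n : ℝ) ^ 3) := by gcongr
    _ = _ := by ring


/-! ## §4 (MIX-3) `−2·tr(Q̇·Γ₀·Ḣ·𝓘)`: the loop leg `T` and the second moment -/

section Mix3

variable {U : Pt → Finset Pt} {W : Finset Pt} {qd : Pt → Pt → Pt → ℝ} {I Γ : Pt → Pt → ℝ} {H : Pt → Pt → Pt → ℝ}
  {A C_I C_Γ C_Γ' C_H δ δH : ℝ} {n : ℕ}

/-- **THE LOOP LEG `T(c,b′,u) = Σ'_{x′} 𝓘(x′,u)·Σ'_x Γ₀(c,x)Ḣ(b′;x,x′)`**: absolutely convergent and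
`|T| ≤ C_I·(C_H·Zl 4 δ_H)·(K₁e^{−(3δ∕4n)‖c−b′‖}∕(‖c−b′‖+1)³ + K₂∕(‖c−b′‖+1)⁸)` with FILE C's `K₁, K₂` (ONLY the sup letter of `𝓘`). [folklore] -/
theorem abs_cubicT_le (hδ : 0 < δ) (hδH : 0 < δH) (hn : 1 ≤ n) (hI0 : ∀ x' u, |I x' u| ≤ C_I) (hΓ0 : ∀ c x, |Γ c x| ≤ C_Γ)
    (hΓ1 : ∀ c t (i : Fin 4), |Γ c (t + Pi.single i 1) - Γ c t|
      ≤ C_Γ' / ((supNorm (c - t) : ℝ) + 1) ^ 3 * Real.exp (-(δ / n) * (supNorm (c - t) : ℝ)))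
    (hH : ∀ b' x x', |H b' x x'| ≤ C_H * Real.exp (-δH * l1 (x - b')) * Real.exp (-δH * l1 (x' - b')))
    (hH0 : ∀ b' x', ∑' x, H b' x x' = 0) (c b' u : Pt) :
    (Summable fun x' => I x' u * ∑' x, Γ c x * H b' x x') ∧
    |∑' x', I x' u * ∑' x, Γ c x * H b' x x'|
      ≤ C_I * (C_H * Zl 4 δH) *
        ((256 / 27 * C_Γ' * (Real.exp (δH / 2) * (2 / δH) * Zl 4 (δH / 2)))
            * (Real.exp (-(3 * δ / 4 / n) * (supNorm (c - b') : ℝ)) / ((supNorm (c - b') : ℝ) + 1) ^ 3)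
          + (2 * C_Γ * 20 ^ 8 * (40320 * Real.exp (δH / 2) * (2 / δH) ^ 8 * Zl 4 (δH / 2))
              + (8 * C_Γ * (Real.exp (δH / 2) * (2 / δH) * Zl 4 (δH / 2)) + 2 * C_Γ * (Real.exp (δH / 2) * Zl 4 (δH / 2))) * 5 ^ 8)
            / ((supNorm (c - b') : ℝ) + 1) ^ 8) := by
  set Φ : ℝ := (256 / 27 * C_Γ' * (Real.exp (δH / 2) * (2 / δH) * Zl 4 (δH / 2)))
            * (Real.exp (-(3 * δ / 4 / n) * (supNorm (c - b') : ℝ)) / ((supNorm (c - b') : ℝ) + 1) ^ 3)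
          + (2 * C_Γ * 20 ^ 8 * (40320 * Real.exp (δH / 2) * (2 / δH) ^ 8 * Zl 4 (δH / 2))
              + (8 * C_Γ * (Real.exp (δH / 2) * (2 / δH) * Zl 4 (δH / 2)) + 2 * C_Γ * (Real.exp (δH / 2) * Zl 4 (δH / 2))) * 5 ^ 8)
            / ((supNorm (c - b') : ℝ) + 1) ^ 8 with hΦ
  have hCI : 0 ≤ C_I := (abs_nonneg _).trans (hI0 b' b')
  have hleg := fun x' => abs_cubicLeg_le hδ hδH hn hΓ0 hΓ1 hH hH0 c b' x'
  -- pointwise majorant `C_I·C_H·Φ·e^{−δ_H|x′−b′|₁}`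
  have hpt : ∀ x', ‖I x' u * ∑' x, Γ c x * H b' x x'‖ ≤ (C_I * C_H * Φ) * Real.exp (-δH * l1 (x' - b')) := by
    intro x'
    rw [Real.norm_eq_abs, abs_mul]
    calc |I x' u| * |∑' x, Γ c x * H b' x x'| ≤ C_I * (C_H * Real.exp (-δH * l1 (x' - b')) * Φ) :=
          mul_le_mul (hI0 x' u) ((hleg x').2.trans (le_of_eq (by rw [hΦ]))) (abs_nonneg _) hCI
      _ = (C_I * C_H * Φ) * Real.exp (-δH * l1 (x' - b')) := by ring
  have HM : HasSum (fun x' : Pt => (C_I * C_H * Φ) * Real.exp (-δH * l1 (x' - b'))) ((C_I * C_H * Φ) * Zl 4 δH) := by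
    have h := (summable_exp_shift' (D := 4) hδH b').hasSum
    rw [tsum_exp_shift'] at h
    exact h.mul_left _
  refine ⟨Summable.of_norm_bounded HM.summable hpt, ?_⟩
  have hb := tsum_of_norm_bounded HM hpt
  rw [Real.norm_eq_abs] at hb
  refine hb.trans (le_of_eq ?_)
  ring

/-- **(MIX-3) SECOND MOMENT, n-FREE** (vertex-first; RHOA-DESIGN §2bis «`n⁻³Σ_z(|z|+1)⁻¹ ~ n⁻³·n³ = O(1)`»): with the letters (q̇-mass) `Σ_{u∈U b,w∈W}|q̇(u;b,b+w)| ≤ A∕n³`,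
field-leg offsets `‖w‖∞ ≤ n`, (𝓘) `|𝓘| ≤ C_I`, (Γ₀) `|Γ₀| ≤ C_Γ`, `|Γ₀(c,t+e_i) − Γ₀(c,t)| ≤ C′_Γ(‖c−t‖+1)⁻³e^{−(δ∕n)‖c−t‖}`, (Ḣ) `|Ḣ(b′;x,x′)| ≤ C_H e^{−δ_H(|x−b′|₁+|x′−b′|₁)}`,
`Σ'_x Ḣ(b′;x,x′) = 0`: for every finite set `S` of second insertions,
`Σ_{b′∈S} ‖b′−b‖∞²·|k₃(b,b′)| ≤ A·C_I·(C_H·Zl 4 δ_H)·𝔎`, `𝔎 = K₁(2(1+160e^{3δ∕8}(8∕(3δ))³) + 2(1+80e^{3δ∕8}(8∕(3δ)))) + 324K₂` — powers `n⁻³·n³`. [folklore] -/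
theorem mix3_secondMoment_le (hδ : 0 < δ) (hδH : 0 < δH) (hn : 1 ≤ n) (hW : ∀ w ∈ W, supNorm w ≤ n)
    (hq : ∀ b, ∑ u ∈ U b, ∑ w ∈ W, |qd u b (b + w)| ≤ A / (n : ℝ) ^ 3) (hI0 : ∀ x' u, |I x' u| ≤ C_I)
    (hΓ0 : ∀ c x, |Γ c x| ≤ C_Γ)
    (hΓ1 : ∀ c t (i : Fin 4), |Γ c (t + Pi.single i 1) - Γ c t|
      ≤ C_Γ' / ((supNorm (c - t) : ℝ) + 1) ^ 3 * Real.exp (-(δ / n) * (supNorm (c - t) : ℝ)))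
    (hH : ∀ b' x x', |H b' x x'| ≤ C_H * Real.exp (-δH * l1 (x - b')) * Real.exp (-δH * l1 (x' - b')))
    (hH0 : ∀ b' x', ∑' x, H b' x x' = 0) (b : Pt) (S : Finset Pt) :
    ∑ b' ∈ S, (supNorm (b' - b) : ℝ) ^ 2 *
        |∑ u ∈ U b, ∑ w ∈ W, qd u b (b + w) * ∑' x', I x' u * ∑' x, Γ (b + w) x * H b' x x'|
      ≤ A * C_I * (C_H * Zl 4 δH) *
        ((256 / 27 * C_Γ' * (Real.exp (δH / 2) * (2 / δH) * Zl 4 (δH / 2)))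
            * (2 * (1 + 160 * Real.exp ((3 * δ / 4) / 2) * (2 / (3 * δ / 4)) ^ 3) + 2 * (1 + 80 * Real.exp ((3 * δ / 4) / 2) * (2 / (3 * δ / 4))))
          + 324 * (2 * C_Γ * 20 ^ 8 * (40320 * Real.exp (δH / 2) * (2 / δH) ^ 8 * Zl 4 (δH / 2))
              + (8 * C_Γ * (Real.exp (δH / 2) * (2 / δH) * Zl 4 (δH / 2)) + 2 * C_Γ * (Real.exp (δH / 2) * Zl 4 (δH / 2))) * 5 ^ 8)) := by
  have hn' : (0 : ℝ) < n := by exact_mod_cast hn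
  have hCI : 0 ≤ C_I := (abs_nonneg _).trans (hI0 b b)
  have hCΓ : 0 ≤ C_Γ := (abs_nonneg _).trans (hΓ0 b b)
  have hCΓ' : 0 ≤ C_Γ' := by
    have h := hΓ1 b b 0
    rw [sub_self, show supNorm (0 : Pt) = 0 from DyadicShell.supNorm_eq_zero_iff.mpr rfl] at h
    norm_num at h
    exact (abs_nonneg _).trans h
  have hCH : 0 ≤ C_H := by
    have h := hH b b b
    rw [sub_self, show l1 (0 : Pt) = 0 by unfold l1; simp, mul_zero, Real.exp_zero, mul_one, mul_one] at h
    exact (abs_nonneg _).trans h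
  have hZ : 0 < Zl 4 δH := Zl_pos hδH
  have hZ2 : 0 < Zl 4 (δH / 2) := Zl_pos (half_pos hδH)
  have hδ' : 0 < 3 * δ / 4 := by positivity
  set K₁ : ℝ := 256 / 27 * C_Γ' * (Real.exp (δH / 2) * (2 / δH) * Zl 4 (δH / 2)) with hK₁
  set K₂ : ℝ := 2 * C_Γ * 20 ^ 8 * (40320 * Real.exp (δH / 2) * (2 / δH) ^ 8 * Zl 4 (δH / 2))
      + (8 * C_Γ * (Real.exp (δH / 2) * (2 / δH) * Zl 4 (δH / 2)) + 2 * C_Γ * (Real.exp (δH / 2) * Zl 4 (δH / 2))) * 5 ^ 8 with hK₂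
  have hK₁0 : 0 ≤ K₁ := by positivity
  have hK₂0 : 0 ≤ K₂ := by positivity
  set L : ℝ := C_I * (C_H * Zl 4 δH) with hL
  have hL0 : 0 ≤ L := by positivity
  set 𝔎 : ℝ := K₁ * (2 * (1 + 160 * Real.exp ((3 * δ / 4) / 2) * (2 / (3 * δ / 4)) ^ 3) + 2 * (1 + 80 * Real.exp ((3 * δ / 4) / 2) * (2 / (3 * δ / 4))))
      + 324 * K₂ with h𝔎
  -- the profile of the leg, as a function of the field point `c` and the second insertion `b′`
  set Φ : Pt → Pt → ℝ := fun c b' =>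
      K₁ * (Real.exp (-((3 * δ / 4) / n) * (supNorm (c - b') : ℝ)) / ((supNorm (c - b') : ℝ) + 1) ^ 3) + K₂ / ((supNorm (c - b') : ℝ) + 1) ^ 8
    with hΦ
  have hT : ∀ c b' u, |∑' x', I x' u * ∑' x, Γ c x * H b' x x'| ≤ L * Φ c b' := by
    intro c b' u
    have h := (abs_cubicT_le (I := I) hδ hδH hn hI0 hΓ0 hΓ1 hH hH0 c b' u).2
    refine h.trans (le_of_eq ?_)
    rw [hL, hΦ, hK₁, hK₂]
  -- step 1: termwise in `b′`
  have h1 : ∀ b' ∈ S, (supNorm (b' - b) : ℝ) ^ 2 *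
      |∑ u ∈ U b, ∑ w ∈ W, qd u b (b + w) * ∑' x', I x' u * ∑' x, Γ (b + w) x * H b' x x'|
        ≤ ∑ u ∈ U b, ∑ w ∈ W, |qd u b (b + w)| * (L * ((supNorm (b' - b) : ℝ) ^ 2 * Φ (b + w) b')) := by
    intro b' _
    have h0 : 0 ≤ (supNorm (b' - b) : ℝ) ^ 2 := by positivity
    calc _ ≤ (supNorm (b' - b) : ℝ) ^ 2 * ∑ u ∈ U b, ∑ w ∈ W, |qd u b (b + w)| * (L * Φ (b + w) b') := by
          refine mul_le_mul_of_nonneg_left ((Finset.abs_sum_le_sum_abs _ _).trans (Finset.sum_le_sum fun u _ =>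
            (Finset.abs_sum_le_sum_abs _ _).trans (Finset.sum_le_sum fun w _ => ?_))) h0
          rw [abs_mul]
          exact mul_le_mul_of_nonneg_left (hT _ _ _) (abs_nonneg _)
      _ = _ := by
          rw [Finset.mul_sum]
          refine Finset.sum_congr rfl fun u _ => ?_
          rw [Finset.mul_sum]
          exact Finset.sum_congr rfl fun w _ => by ring
  -- step 2: swap and use the profile's second moment
  have h2 : ∀ u ∈ U b, ∀ w ∈ W, ∑ b' ∈ S, |qd u b (b + w)| * (L * ((supNorm (b' - b) : ℝ) ^ 2 * Φ (b + w) b'))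
      ≤ |qd u b (b + w)| * (L * (𝔎 * (n : ℝ) ^ 3)) := by
    intro u _ w hw
    rw [← Finset.mul_sum, ← Finset.mul_sum]
    refine mul_le_mul_of_nonneg_left (mul_le_mul_of_nonneg_left ?_ hL0) (abs_nonneg _)
    have hc : supNorm (b + w - b) ≤ n := by rw [add_sub_cancel_left]; exact hW w hw
    have h := sum_sq_shift_mixedProfile_le hδ' hK₁0 hK₂0 hn (c := b + w) hc S
    rw [h𝔎]
    refine le_trans (le_of_eq (Finset.sum_congr rfl fun b' _ => by rw [hΦ])) h
  calc _ ≤ ∑ b' ∈ S, ∑ u ∈ U b, ∑ w ∈ W, |qd u b (b + w)| * (L * ((supNorm (b' - b) : ℝ) ^ 2 * Φ (b + w) b')) :=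
        Finset.sum_le_sum h1
    _ = ∑ u ∈ U b, ∑ w ∈ W, ∑ b' ∈ S, |qd u b (b + w)| * (L * ((supNorm (b' - b) : ℝ) ^ 2 * Φ (b + w) b')) := by
        rw [Finset.sum_comm]; exact Finset.sum_congr rfl fun u _ => Finset.sum_comm
    _ ≤ ∑ u ∈ U b, ∑ w ∈ W, |qd u b (b + w)| * (L * (𝔎 * (n : ℝ) ^ 3)) :=
        Finset.sum_le_sum fun u hu => Finset.sum_le_sum fun w hw => h2 u hu w hw
    _ = (∑ u ∈ U b, ∑ w ∈ W, |qd u b (b + w)|) * (L * (𝔎 * (n : ℝ) ^ 3)) := by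
        rw [Finset.sum_mul]; exact Finset.sum_congr rfl fun u _ => by rw [Finset.sum_mul]
    _ ≤ (A / (n : ℝ) ^ 3) * (L * (𝔎 * (n : ℝ) ^ 3)) := by
        have : 0 ≤ 𝔎 := by positivity
        exact mul_le_mul_of_nonneg_right (hq b) (by positivity)
    _ = A * C_I * (C_H * Zl 4 δH) * 𝔎 := by
        rw [hL]; field_simp

/-- **(MIX-3) SUMMABLE SECOND MOMENT OVER `ℤ⁴`** (the `tsum` form, for RHOA-6e ∕ RHOA-8's `HasSum` bookkeeping). [folklore] -/
theorem tsum_mix3_secondMoment_le (hδ : 0 < δ) (hδH : 0 < δH) (hn : 1 ≤ n) (hW : ∀ w ∈ W, supNorm w ≤ n)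
    (hq : ∀ b, ∑ u ∈ U b, ∑ w ∈ W, |qd u b (b + w)| ≤ A / (n : ℝ) ^ 3) (hI0 : ∀ x' u, |I x' u| ≤ C_I)
    (hΓ0 : ∀ c x, |Γ c x| ≤ C_Γ)
    (hΓ1 : ∀ c t (i : Fin 4), |Γ c (t + Pi.single i 1) - Γ c t|
      ≤ C_Γ' / ((supNorm (c - t) : ℝ) + 1) ^ 3 * Real.exp (-(δ / n) * (supNorm (c - t) : ℝ)))
    (hH : ∀ b' x x', |H b' x x'| ≤ C_H * Real.exp (-δH * l1 (x - b')) * Real.exp (-δH * l1 (x' - b')))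
    (hH0 : ∀ b' x', ∑' x, H b' x x' = 0) (b : Pt) :
    (Summable fun b' : Pt => (supNorm (b' - b) : ℝ) ^ 2 *
        |∑ u ∈ U b, ∑ w ∈ W, qd u b (b + w) * ∑' x', I x' u * ∑' x, Γ (b + w) x * H b' x x'|) ∧
    ∑' b' : Pt, (supNorm (b' - b) : ℝ) ^ 2 *
        |∑ u ∈ U b, ∑ w ∈ W, qd u b (b + w) * ∑' x', I x' u * ∑' x, Γ (b + w) x * H b' x x'|
      ≤ A * C_I * (C_H * Zl 4 δH) *
        ((256 / 27 * C_Γ' * (Real.exp (δH / 2) * (2 / δH) * Zl 4 (δH / 2)))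
            * (2 * (1 + 160 * Real.exp ((3 * δ / 4) / 2) * (2 / (3 * δ / 4)) ^ 3) + 2 * (1 + 80 * Real.exp ((3 * δ / 4) / 2) * (2 / (3 * δ / 4))))
          + 324 * (2 * C_Γ * 20 ^ 8 * (40320 * Real.exp (δH / 2) * (2 / δH) ^ 8 * Zl 4 (δH / 2))
              + (8 * C_Γ * (Real.exp (δH / 2) * (2 / δH) * Zl 4 (δH / 2)) + 2 * C_Γ * (Real.exp (δH / 2) * Zl 4 (δH / 2))) * 5 ^ 8)) := by
  have h := mix3_secondMoment_le (U := U) (qd := qd) (I := I) (Γ := Γ) (H := H) hδ hδH hn hW hq hI0 hΓ0 hΓ1 hH hH0 b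
  have h0 : 0 ≤ fun b' : Pt => (supNorm (b' - b) : ℝ) ^ 2 *
      |∑ u ∈ U b, ∑ w ∈ W, qd u b (b + w) * ∑' x', I x' u * ∑' x, Γ (b + w) x * H b' x x'| := fun b' => by positivity
  exact ⟨summable_of_sum_le h0 h, Real.tsum_le_of_sum_le h0 h⟩

end Mix3

end Summit.QuantumFields.BalabanUV.Beta.FP.MixLoopPowerCountingCubicMoment

end
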